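import Literature.MathematicalPhysics.QuantumLattice.PairCorrelationsProofs
import Literature.Barriers.HubbardSuperconductivity.PureModelStripeCompetitionProofs

/-!
# Route `BalabanIR`, crux 5 `BirEveryGroundState` (`stmt-HubbardSuperconductivity-2083`):
# the Theses-free closing socket, and the exact content of the conclusion

This module deliberately imports NO route file (`…Theses.BalabanIR`) and no Theorems module that
does (rev-5 MATERIALISATION RULE of the route: the gate links `<Decl>_holds` by importing the
closing module into the route file, so a closing module must not import the route file, directly or
transitively; all earlier helper files of this crux — `BalabanIRBirEveryGroundState*.lean` — do
import it and can therefore never be imported by a closing module). Everything here is stated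
STRUCTURALLY, over Literature declarations only.

* (inside `forall_hasLRO_iff_groundState_bound`, direction ⇐) at one coupling `U`: an eventual
  bound `c L⁴ ≤ re ⟨ψ, Δ_d† Δ_d ψ⟩` for EVERY normalised sector ground state at the even sides
  `L ≥ L₀` gives the summit's conclusion (`HasLongRangeOrder` along the even sides) for every
  admissible sequence (`liminf` bookkeeping; the route-file-importing companion
  `BalabanIRBirEveryGroundState.lean` has this direction as `hasLRO_of_forall_groundState_bound`).
* `exists_unit_groundState_isMinOn` — at every side there is a normalised sector ground state
  MINIMISING `re ⟨ψ, A ψ⟩` among normalised sector ground states (compactness of the unit sphere of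
  the finite-dimensional ground eigenspace).
* `groundState_bound_of_forall_hasLRO` — THE CONVERSE: if every admissible sequence of normalised
  sector ground states at coupling `U` has `d_{x²-y²}` pair-field LRO along the even sides, then
  there ARE `c > 0` and `L₀` with `c L⁴ ≤ re ⟨ψ, Δ_d† Δ_d ψ⟩` for every normalised sector ground
  state at every even side `L ≥ L₀` (test the sequence of minimisers). Hence
  `forall_hasLRO_iff_groundState_bound`: the conclusion of the crux at `(U, δ)` is EXACTLY an
  eventual uniform lower bound `c L⁴` on the bottom of the compression of `Δ_d† Δ_d` to the sector
  ground eigenspaces — no more, no less.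
* `birEveryGroundState_structural_of_transfer` — THE SOCKET: the body of
  `Theses.BalabanIR.BirEveryGroundState`, verbatim, from the transfer hypothesis "window average
  bound ⇒ at some coupling of the window an eventual every-ground-state bound". Any future proof of
  the residual genericity statement, in whatever form (scalar ground compressions, irreducible
  ground multiplets, ground-state uniqueness, κ-chord response, second-moment clause — see the
  companion files), factors through this hypothesis (by `forall_hasLRO_iff_groundState_bound` it
  must), and then closes the item by the three-line file
  `theorem birEveryGroundState_proof : <body> := birEveryGroundState_structural_of_transfer h`
  without touching the route file.

Scalapino, Phys. Rep. 250 (1995) 329, §2 eq. (2.4); Friedli–Velenik (2017) §3.7.2 (LRO as a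
`liminf`); Lieb, PRL 62 (1989) 1201 (sectors). Everything is folklore; no definition is introduced.
-/

noncomputable section

namespace Summit.HubbardSuperconductivity.HubbardSuperconductivity.Theorems

open Matrix Finset Filter
open Literature.Probability.LatticeModels Literature.MathematicalPhysics.QuantumLattice
open scoped ComplexOrder

/-! ### Minimisers over the normalised sector ground states -/

/-- **A worst ground state exists.** For every side `L` (degenerate tori `L = 0, 1` included),
coupling `U`, `n ≤ L²` and every matrix `A` there is a normalised ground state of
`hubbardTorus 2 L 1 U` in the sector `(2n, S^z = 0)` minimising `re ⟨ψ, A ψ⟩` among all normalised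
ground states of that sector: these form a nonempty
(`exists_unit_isGroundStateInSector_hubbardTorus`) closed and bounded, hence compact, subset of the
finite-dimensional Fock space, on which `ψ ↦ re ⟨ψ, A ψ⟩` is continuous. Lieb, PRL 62 (1989) 1201
(sectors); extreme value theorem. [folklore] -/
theorem exists_unit_groundState_isMinOn (U : ℝ) (L n : ℕ) (hn : n ≤ L ^ 2)
    (A : Matrix (Finset (Orb (FermionTorus 2 L))) (Finset (Orb (FermionTorus 2 L))) ℂ) :
    ∃ ψ : Fock (Orb (FermionTorus 2 L)), star ψ ⬝ᵥ ψ = 1 ∧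
      IsGroundStateInSector (hubbardTorus 2 L 1 U) (2 * n) 0 ψ ∧
      ∀ φ : Fock (Orb (FermionTorus 2 L)), star φ ⬝ᵥ φ = 1 →
        IsGroundStateInSector (hubbardTorus 2 L 1 U) (2 * n) 0 φ →
        (star ψ ⬝ᵥ A *ᵥ ψ).re ≤ (star φ ⬝ᵥ A *ᵥ φ).re := by
  classical
  -- the set of normalised sector ground states, written with closed conditions only
  let S : Set (Fock (Orb (FermionTorus 2 L))) :=
    {φ | star φ ⬝ᵥ φ = 1 ∧ φ ∈ szSector (Λ := FermionTorus 2 L) (2 * n) 0 ∧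
      hubbardTorus 2 L 1 U *ᵥ φ =
        (((hubbardTorus 2 L 1 U).minEnergyOn (szSector (Λ := FermionTorus 2 L) (2 * n) 0) : ℝ) :
          ℂ) • φ}
  have hS : ∀ φ, φ ∈ S ↔ star φ ⬝ᵥ φ = 1 ∧ IsGroundStateInSector (hubbardTorus 2 L 1 U) (2 * n) 0 φ := by
    intro φ
    constructor
    · rintro ⟨h1, h2, h3⟩
      refine ⟨h1, h2, ?_, h3⟩
      rintro rfl
      simp at h1
    · rintro ⟨h1, h2, -, h3⟩
      exact ⟨h1, h2, h3⟩
  have hclosed : IsClosed S := by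
    refine (isClosed_eq (continuous_star.dotProduct continuous_id) continuous_const).inter
      ((Submodule.closed_of_finiteDimensional _).inter
        (isClosed_eq (continuous_const.matrix_mulVec continuous_id) (continuous_const_smul _)))
  have hbdd : Bornology.IsBounded S := by
    refine (Metric.isBounded_closedBall (x := (0 : Fock (Orb (FermionTorus 2 L)))) (r := 1)).subset
      ?_
    rintro φ ⟨h1, -, -⟩
    rw [Metric.mem_closedBall, dist_zero_right]
    have hn2 : ‖(WithLp.toLp 2 φ : EuclideanSpace ℂ (Finset (Orb (FermionTorus 2 L))))‖ = 1 := by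
      have h2 := norm_toLp_sq_eq_re φ
      rw [h1, Complex.one_re] at h2
      exact (pow_eq_one_iff_of_nonneg (norm_nonneg _) two_ne_zero).1 h2
    refine (pi_norm_le_iff_of_nonneg zero_le_one).2 fun s => ?_
    calc ‖φ s‖ = ‖(WithLp.toLp 2 φ : EuclideanSpace ℂ (Finset (Orb (FermionTorus 2 L)))) s‖ := rfl
      _ ≤ ‖(WithLp.toLp 2 φ : EuclideanSpace ℂ (Finset (Orb (FermionTorus 2 L))))‖ :=
          PiLp.norm_apply_le _ _
      _ = 1 := hn2
  have hcpt : IsCompact S := Metric.isCompact_of_isClosed_isBounded hclosed hbdd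
  have hne : S.Nonempty := by
    obtain ⟨ψ, h1, h2⟩ :=
      Literature.Barriers.HubbardSuperconductivity.exists_unit_isGroundStateInSector_hubbardTorus
        U L n hn
    exact ⟨ψ, (hS ψ).2 ⟨h1, h2⟩⟩
  have hcont : Continuous fun φ : Fock (Orb (FermionTorus 2 L)) => (star φ ⬝ᵥ A *ᵥ φ).re :=
    Complex.continuous_re.comp
      (continuous_star.dotProduct (continuous_const.matrix_mulVec continuous_id))
  obtain ⟨ψ, hψS, hmin⟩ := hcpt.exists_isMinOn hne hcont.continuousOn
  exact ⟨ψ, ((hS ψ).1 hψS).1, ((hS ψ).1 hψS).2, fun φ h1 h2 => hmin ((hS φ).2 ⟨h1, h2⟩)⟩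

/-! ### The converse: LRO of every admissible sequence ⇒ an eventual every-ground-state bound -/

/-- **LRO of EVERY admissible sequence at one coupling forces an eventual uniform bound.** Fix `U`
and `δ ≥ -1`. If every admissible sequence `(N, ψ)` (at the even sides: `N_L = 2⌊(1-δ)L²/2⌋`,
`‖ψ_L‖ = 1`, `ψ_L` a ground state of `hubbardTorus 2 L 1 U` in the sector `(N_L, S^z = 0)`) has
`d_{x²-y²}` pair-field long-range order along the even sides, then there are `c > 0` and `L₀` such
that `c L⁴ ≤ re ⟨ψ, Δ_d† Δ_d ψ⟩` for EVERY normalised sector ground state at EVERY even side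
`L ≥ L₀`. Proof: test the admissible sequence of worst ground states
(`exists_unit_groundState_isMinOn`); were the bound to fail for every `c` and `L₀`, its LRO
sequence — nonnegative, and equal to `(2k)⁻⁴ re ⟨ψ_{2k}, Δ_d† Δ_d ψ_{2k}⟩` at `k ≥ 1`
(`torusLROSeq_pairFieldCorr_succ`) — would be frequently `≤ c` for every `c > 0`, so its `liminf`
would vanish. Together with the converse bookkeeping this identifies the conclusion of crux `BirEveryGroundState` at `(U, δ)` with an eventual uniform lower bound on the
bottom of the compressions of `Δ_d† Δ_d` to the sector ground eigenspaces.
Scalapino, Phys. Rep. 250 (1995) 329, §2 eq. (2.4); Friedli–Velenik (2017) §3.7.2. [folklore] -/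
theorem groundState_bound_of_forall_hasLRO (U δ : ℝ) (hδ : -1 ≤ δ)
    (h : ∀ (N : ℕ → ℕ) (ψ : ∀ L, Fock (Orb (FermionTorus 2 L))),
      (∀ L, Even L → N L = 2 * ⌊(1 - δ) * (L : ℝ) ^ 2 / 2⌋₊ ∧ star (ψ L) ⬝ᵥ ψ L = 1 ∧
        IsGroundStateInSector (hubbardTorus 2 L 1 U) (N L) 0 (ψ L)) →
      HasLongRangeOrder (fun k => halfOpenBox 2 (2 * k))
        (fun k => torusPullback (pairFieldCorr dWaveFormFactor ψ) (2 * k))) :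
    ∃ c : ℝ, 0 < c ∧ ∃ L₀ : ℕ, ∀ (L : ℕ) [NeZero L], L₀ ≤ L → Even L →
      ∀ ψ : Fock (Orb (FermionTorus 2 L)),
        IsGroundStateInSector (hubbardTorus 2 L 1 U) (2 * ⌊(1 - δ) * (L : ℝ) ^ 2 / 2⌋₊) 0 ψ →
        star ψ ⬝ᵥ ψ = 1 →
        c * (L : ℝ) ^ 4 ≤
          (star ψ ⬝ᵥ ((pairField dWaveFormFactor L)ᴴ * pairField dWaveFormFactor L) *ᵥ ψ).re := by
  classical
  -- worst ground states at every side (at the empty torus `L = 0` any ground state will do)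
  have key : ∀ L : ℕ, ∃ ψ : Fock (Orb (FermionTorus 2 L)), star ψ ⬝ᵥ ψ = 1 ∧
      IsGroundStateInSector (hubbardTorus 2 L 1 U) (2 * ⌊(1 - δ) * (L : ℝ) ^ 2 / 2⌋₊) 0 ψ ∧
      ∀ [NeZero L], ∀ φ : Fock (Orb (FermionTorus 2 L)), star φ ⬝ᵥ φ = 1 →
        IsGroundStateInSector (hubbardTorus 2 L 1 U) (2 * ⌊(1 - δ) * (L : ℝ) ^ 2 / 2⌋₊) 0 φ →
        (star ψ ⬝ᵥ ((pairField dWaveFormFactor L)ᴴ * pairField dWaveFormFactor L) *ᵥ ψ).re ≤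
          (star φ ⬝ᵥ ((pairField dWaveFormFactor L)ᴴ * pairField dWaveFormFactor L) *ᵥ φ).re := by
    intro L
    rcases Nat.eq_zero_or_pos L with rfl | hL
    · obtain ⟨ψ, h1, h2⟩ :=
        Literature.Barriers.HubbardSuperconductivity.exists_unit_isGroundStateInSector_hubbardTorus
          U 0 _ (Literature.Barriers.HubbardSuperconductivity.natFloor_filling_le_sq hδ 0)
      exact ⟨ψ, h1, h2, fun φ _ _ => (NeZero.ne (0 : ℕ) rfl).elim⟩
    · haveI : NeZero L := ⟨hL.ne'⟩
      obtain ⟨ψ, h1, h2, h3⟩ := exists_unit_groundState_isMinOn U L _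
        (Literature.Barriers.HubbardSuperconductivity.natFloor_filling_le_sq hδ L)
        ((pairField dWaveFormFactor L)ᴴ * pairField dWaveFormFactor L)
      exact ⟨ψ, h1, h2, fun φ hφ1 hφ2 => h3 φ hφ1 hφ2⟩
  choose ψ hψunit hψgs hψmin using key
  have hLRO := h (fun L => 2 * ⌊(1 - δ) * (L : ℝ) ^ 2 / 2⌋₊) ψ
    (fun L _ => ⟨rfl, hψunit L, hψgs L⟩)
  by_contra hcon
  unfold HasLongRangeOrder at hLRO
  -- the LRO sequence of the worst sequence is nonnegative ...
  have hnonneg' : ∀ m : ℕ, 0 ≤ (∑ x ∈ halfOpenBox 2 (m + 1), ∑ y ∈ halfOpenBox 2 (m + 1),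
      torusPullback (pairFieldCorr dWaveFormFactor ψ) (m + 1) x y) /
        ((halfOpenBox 2 (m + 1)).card : ℝ) ^ 2 := by
    intro m
    rw [torusLROSeq_pairFieldCorr_succ, PosSemidefTrace.expect_conjTranspose_mul,
      ← norm_toLp_sq_eq_re]
    positivity
  have hnonneg : ∀ k : ℕ, 0 ≤ (∑ x ∈ halfOpenBox 2 (2 * k), ∑ y ∈ halfOpenBox 2 (2 * k),
      torusPullback (pairFieldCorr dWaveFormFactor ψ) (2 * k) x y) /
        ((halfOpenBox 2 (2 * k)).card : ℝ) ^ 2 := by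
    intro k
    cases k with
    | zero =>
      have h0 : ((halfOpenBox 2 (2 * 0)).card : ℝ) ^ 2 = 0 := by rw [card_halfOpenBox]; simp
      rw [h0, div_zero]
    | succ k => exact hnonneg' (2 * k + 1)
  -- ... and, the bound failing for every `c` and `L₀`, frequently `≤ c` for every `c > 0`:
  -- at a positive side a bad ground state `φ` drags the worst one below `c`
  have hstep : ∀ (c : ℝ) (m : ℕ) (φ : Fock (Orb (FermionTorus 2 (m + 1)))), star φ ⬝ᵥ φ = 1 →
      IsGroundStateInSector (hubbardTorus 2 (m + 1) 1 U)
        (2 * ⌊(1 - δ) * ((m + 1 : ℕ) : ℝ) ^ 2 / 2⌋₊) 0 φ →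
      (star φ ⬝ᵥ ((pairField dWaveFormFactor (m + 1))ᴴ * pairField dWaveFormFactor (m + 1)) *ᵥ
        φ).re < c * ((m + 1 : ℕ) : ℝ) ^ 4 →
      (∑ x ∈ halfOpenBox 2 (m + 1), ∑ y ∈ halfOpenBox 2 (m + 1),
        torusPullback (pairFieldCorr dWaveFormFactor ψ) (m + 1) x y) /
          ((halfOpenBox 2 (m + 1)).card : ℝ) ^ 2 ≤ c := by
    intro c m φ hφunit hφgs hlt
    rw [torusLROSeq_pairFieldCorr_succ, div_le_iff₀ (by positivity)]
    exact (hψmin (m + 1) φ hφunit hφgs).trans hlt.le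
  have hfreq : ∀ c : ℝ, 0 < c → ∃ᶠ k in atTop,
      (∑ x ∈ halfOpenBox 2 (2 * k), ∑ y ∈ halfOpenBox 2 (2 * k),
        torusPullback (pairFieldCorr dWaveFormFactor ψ) (2 * k) x y) /
          ((halfOpenBox 2 (2 * k)).card : ℝ) ^ 2 ≤ c := by
    intro c hc
    refine frequently_atTop.2 fun K => ?_
    -- failure of the bound with constant `c` beyond the side `2K + 1`
    have hfail : ¬ ∀ (L : ℕ) [NeZero L], 2 * K + 1 ≤ L → Even L →
        ∀ φ : Fock (Orb (FermionTorus 2 L)),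
          IsGroundStateInSector (hubbardTorus 2 L 1 U) (2 * ⌊(1 - δ) * (L : ℝ) ^ 2 / 2⌋₊) 0 φ →
          star φ ⬝ᵥ φ = 1 →
          c * (L : ℝ) ^ 4 ≤
            (star φ ⬝ᵥ ((pairField dWaveFormFactor L)ᴴ * pairField dWaveFormFactor L) *ᵥ φ).re :=
      fun hall => hcon ⟨c, hc, 2 * K + 1, hall⟩
    push Not at hfail
    obtain ⟨L, _inst, hKL, hev, φ, hφgs, hφunit, hlt⟩ := hfail
    obtain ⟨r, hr⟩ := hev.two_dvd
    subst hr
    obtain ⟨k, rfl⟩ : ∃ k, r = k + 1 := ⟨r - 1, by omega⟩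
    exact ⟨k + 1, by omega, hstep c (2 * k + 1) φ hφunit hφgs hlt⟩
  -- hence its liminf vanishes, contradicting long-range order of the worst sequence
  have hlim : liminf (fun k : ℕ => (∑ x ∈ halfOpenBox 2 (2 * k), ∑ y ∈ halfOpenBox 2 (2 * k),
      torusPullback (pairFieldCorr dWaveFormFactor ψ) (2 * k) x y) /
        ((halfOpenBox 2 (2 * k)).card : ℝ) ^ 2) atTop ≤ 0 := by
    refine le_of_forall_pos_le_add fun c hc => ?_
    rw [zero_add]
    exact liminf_le_of_frequently_le (hfreq c hc) (isBoundedUnder_of ⟨0, fun k => hnonneg k⟩)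
  exact absurd hLRO (not_lt.2 hlim)

/-- **The conclusion of crux `BirEveryGroundState` at `(U, δ)`, exactly.** For `δ ≥ -1` (so
throughout the summit's range) the following are equivalent: (i) every admissible sequence of
normalised `(2⌊(1-δ)L²/2⌋, S^z = 0)`-sector ground states of `hubbardTorus 2 L 1 U` has
`d_{x²-y²}` pair-field long-range order along the even sides (the verbatim body of the summit's
matrix `HasDWavePairFieldLROAt U δ`); (ii) there are `c > 0` and `L₀` with
`c L⁴ ≤ re ⟨ψ, Δ_d† Δ_d ψ⟩` for every normalised sector ground state at every even side `L ≥ L₀`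
— an eventual uniform lower bound of order `L⁴` on the smallest eigenvalue of the compression of
`Δ_d† Δ_d` to the sector ground eigenspace. (i) ⇒ (ii) is `groundState_bound_of_forall_hasLRO`;
(ii) ⇒ (i): the LRO sequence of an admissible sequence is eventually `≥ c`
(`torusLROSeq_pairFieldCorr_succ`) and bounded by `C_d²` at every `k ≥ 1` (`pairFieldCorr_succ_le`),
so its `liminf` is `≥ c > 0`. So "average ⇒ every" is precisely "average eigenvalue ⇒ bottom
eigenvalue of the ground compression", eventually in even `L`, at one coupling of each window. Scalapino, Phys. Rep. 250 (1995) 329, §2; Friedli–Velenik (2017) §3.7.2. [folklore] -/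
theorem forall_hasLRO_iff_groundState_bound (U δ : ℝ) (hδ : -1 ≤ δ) :
    (∀ (N : ℕ → ℕ) (ψ : ∀ L, Fock (Orb (FermionTorus 2 L))),
      (∀ L, Even L → N L = 2 * ⌊(1 - δ) * (L : ℝ) ^ 2 / 2⌋₊ ∧ star (ψ L) ⬝ᵥ ψ L = 1 ∧
        IsGroundStateInSector (hubbardTorus 2 L 1 U) (N L) 0 (ψ L)) →
      HasLongRangeOrder (fun k => halfOpenBox 2 (2 * k))
        (fun k => torusPullback (pairFieldCorr dWaveFormFactor ψ) (2 * k))) ↔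
    ∃ c : ℝ, 0 < c ∧ ∃ L₀ : ℕ, ∀ (L : ℕ) [NeZero L], L₀ ≤ L → Even L →
      ∀ ψ : Fock (Orb (FermionTorus 2 L)),
        IsGroundStateInSector (hubbardTorus 2 L 1 U) (2 * ⌊(1 - δ) * (L : ℝ) ^ 2 / 2⌋₊) 0 ψ →
        star ψ ⬝ᵥ ψ = 1 →
        c * (L : ℝ) ^ 4 ≤
          (star ψ ⬝ᵥ ((pairField dWaveFormFactor L)ᴴ * pairField dWaveFormFactor L) *ᵥ ψ).re := by
  refine ⟨groundState_bound_of_forall_hasLRO U δ hδ, ?_⟩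
  rintro ⟨c, hc, L₀, h⟩ N ψ hadm
  -- every-ground-state bound ⇒ LRO of every admissible sequence (`liminf` bookkeeping)
  unfold HasLongRangeOrder
  set Cd : ℝ := ∑ e ∈ insert 0 unitSteps, ‖((dWaveFormFactor e / Real.sqrt 2 : ℝ) : ℂ)‖ * 2
    with hCd
  -- the LRO sequence at a positive side `m + 1`, for a vector normalised there, is `≤ C_d²`
  have hup' : ∀ m : ℕ, star (ψ (m + 1)) ⬝ᵥ ψ (m + 1) = 1 →
      (∑ x ∈ halfOpenBox 2 (m + 1), ∑ y ∈ halfOpenBox 2 (m + 1),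
        torusPullback (pairFieldCorr dWaveFormFactor ψ) (m + 1) x y) /
          ((halfOpenBox 2 (m + 1)).card : ℝ) ^ 2 ≤ Cd ^ 2 := by
    intro m hnorm
    rw [torusLROSeq_pairFieldCorr_succ, div_le_iff₀ (by positivity), ← sum_pairFieldCorr_succ]
    calc ∑ x : TorusSite 2 (m + 1), ∑ y, pairFieldCorr dWaveFormFactor ψ (m + 1) x y
        ≤ ∑ _x : TorusSite 2 (m + 1), ∑ _y : TorusSite 2 (m + 1), Cd ^ 2 :=
          Finset.sum_le_sum fun x _ => Finset.sum_le_sum fun y _ =>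
            pairFieldCorr_succ_le dWaveFormFactor ψ m hnorm x y
      _ = Cd ^ 2 * ((m + 1 : ℕ) : ℝ) ^ 4 := by
          simp only [Finset.sum_const, Finset.card_univ, Fintype.card_pi, ZMod.card,
            Finset.prod_const, Fintype.card_fin, nsmul_eq_mul]
          push_cast
          ring
  -- the LRO sequence at a good even side `m + 1 ≥ L₀` is `≥ c`
  have hlow' : ∀ m : ℕ, L₀ ≤ m + 1 → Even (m + 1) →
      c ≤ (∑ x ∈ halfOpenBox 2 (m + 1), ∑ y ∈ halfOpenBox 2 (m + 1),
        torusPullback (pairFieldCorr dWaveFormFactor ψ) (m + 1) x y) /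
          ((halfOpenBox 2 (m + 1)).card : ℝ) ^ 2 := by
    intro m hm hev
    obtain ⟨hN, hunit, hgs⟩ := hadm (m + 1) hev
    rw [hN] at hgs
    have hb := h (m + 1) hm hev (ψ (m + 1)) hgs hunit
    rw [torusLROSeq_pairFieldCorr_succ, le_div_iff₀ (by positivity)]
    exact hb
  -- upper bound at every `k` (uses only the normalisation at the even side `2k`)
  have hup : ∀ k : ℕ, (∑ x ∈ halfOpenBox 2 (2 * k), ∑ y ∈ halfOpenBox 2 (2 * k),
      torusPullback (pairFieldCorr dWaveFormFactor ψ) (2 * k) x y) /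
        ((halfOpenBox 2 (2 * k)).card : ℝ) ^ 2 ≤ Cd ^ 2 := by
    intro k
    cases k with
    | zero =>
      have h0 : ((halfOpenBox 2 (2 * 0)).card : ℝ) ^ 2 = 0 := by rw [card_halfOpenBox]; simp
      rw [h0, div_zero]
      positivity
    | succ k =>
      have hev : Even (2 * k + 1 + 1) := ⟨k + 1, by ring⟩
      exact hup' (2 * k + 1) (hadm (2 * k + 1 + 1) hev).2.1
  -- lower bound, eventually
  have hlow : ∀ᶠ k : ℕ in atTop, c ≤ (∑ x ∈ halfOpenBox 2 (2 * k), ∑ y ∈ halfOpenBox 2 (2 * k),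
      torusPullback (pairFieldCorr dWaveFormFactor ψ) (2 * k) x y) /
        ((halfOpenBox 2 (2 * k)).card : ℝ) ^ 2 := by
    refine eventually_atTop.2 ⟨L₀ + 1, fun k hk => ?_⟩
    obtain ⟨k, rfl⟩ : ∃ k', k = k' + 1 := ⟨k - 1, by omega⟩
    have hev : Even (2 * k + 1 + 1) := ⟨k + 1, by ring⟩
    exact hlow' (2 * k + 1) (by omega) hev
  exact lt_of_lt_of_le hc
    (le_liminf_of_le (isCoboundedUnder_ge_of_eventually_le _ (Eventually.of_forall hup)) hlow)


/-! ### The closing socket: the item's body, verbatim, from the transfer hypothesis -/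

/-- **THE SOCKET for crux 5.** The body of `Theses.BalabanIR.BirEveryGroundState` (item
`stmt-HubbardSuperconductivity-2083`), verbatim and route-file-free, from the TRANSFER hypothesis:
for all data `(δ, U₁, U₂, c)` the ground-state-AVERAGE bound on the window yields ONE coupling
`U ∈ (U₁, U₂)`, a constant `c' > 0` and a threshold beyond which every normalised sector ground
state at even sides has `c' L⁴ ≤ re ⟨ψ, Δ_d† Δ_d ψ⟩` (then direction ⇐ of
`forall_hasLRO_iff_groundState_bound`). By `forall_hasLRO_iff_groundState_bound` the
transfer hypothesis is not only sufficient but EQUIVALENT to the crux, so every mechanism for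
average → every (Kato–Schur genericity, ground-state uniqueness, κ-chord response, second moments)
must pass through it; a closing module proves the hypothesis `h` over Literature declarations and
ends with `birEveryGroundState_structural_of_transfer h`, never importing the route file.
Scalapino, Phys. Rep. 250 (1995) 329, §2; Kato (1966) II §6.1 for the context. [folklore] -/
theorem birEveryGroundState_structural_of_transfer
    (h : ∀ (δ U₁ U₂ c : ℝ), δ ∈ Set.Ioo (0:ℝ) (1/2) → 0 < U₁ → U₁ < U₂ → 0 < c →
      (∀ U ∈ Set.Ioo U₁ U₂, ∃ L₀ : ℕ, ∀ (L : ℕ) [NeZero L], L₀ ≤ L → Even L →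
        let N : ℕ := 2 * ⌊(1 - δ) * (L : ℝ) ^ 2 / 2⌋₊
        let H := hubbardTorus 2 L 1 U
        let S := szSector (Λ := FermionTorus 2 L) N 0
        let E₀ := S ⊓ Module.End.eigenspace (Matrix.toLin' H) ((H.minEnergyOn S : ℝ) : ℂ)
        let P := projMatrix (E₀.map (Fock.toEuclidean (ι := Orb (FermionTorus 2 L)) :
          Fock (Orb (FermionTorus 2 L)) →ₗ[ℂ] EuclideanSpace ℂ (Finset (Orb (FermionTorus 2 L)))))
        c * (L : ℝ) ^ 4 * P.trace.re ≤
          (P * ((pairField dWaveFormFactor L)ᴴ * pairField dWaveFormFactor L)).trace.re) →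
      ∃ U ∈ Set.Ioo U₁ U₂, ∃ c' : ℝ, 0 < c' ∧ ∃ L₀ : ℕ, ∀ (L : ℕ) [NeZero L], L₀ ≤ L → Even L →
        ∀ ψ : Fock (Orb (FermionTorus 2 L)),
          IsGroundStateInSector (hubbardTorus 2 L 1 U) (2 * ⌊(1 - δ) * (L : ℝ) ^ 2 / 2⌋₊) 0 ψ →
          star ψ ⬝ᵥ ψ = 1 →
          c' * (L : ℝ) ^ 4 ≤
            (star ψ ⬝ᵥ ((pairField dWaveFormFactor L)ᴴ * pairField dWaveFormFactor L) *ᵥ ψ).re) :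
    ∀ (δ U₁ U₂ c : ℝ), δ ∈ Set.Ioo (0:ℝ) (1/2) → 0 < U₁ → U₁ < U₂ → 0 < c → (∀ U ∈ Set.Ioo U₁ U₂, ∃ L₀ : ℕ, ∀ (L : ℕ) [NeZero L], L₀ ≤ L → Even L → let N : ℕ := 2 * ⌊(1 - δ) * (L : ℝ) ^ 2 / 2⌋₊; let H := Literature.MathematicalPhysics.QuantumLattice.hubbardTorus 2 L 1 U; let S := Literature.MathematicalPhysics.QuantumLattice.szSector (Λ := Literature.MathematicalPhysics.QuantumLattice.FermionTorus 2 L) N 0; let E₀ := S ⊓ Module.End.eigenspace (Matrix.toLin' H) ((H.minEnergyOn S : ℝ) : ℂ); let P := Literature.MathematicalPhysics.QuantumLattice.projMatrix (E₀.map (Literature.MathematicalPhysics.QuantumLattice.Fock.toEuclidean (ι := Literature.MathematicalPhysics.QuantumLattice.Orb (Literature.MathematicalPhysics.QuantumLattice.FermionTorus 2 L)) : Literature.MathematicalPhysics.QuantumLattice.Fock (Literature.MathematicalPhysics.QuantumLattice.Orb (Literature.MathematicalPhysics.QuantumLattice.FermionTorus 2 L)) →ₗ[ℂ] EuclideanSpace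 ℂ (Finset (Literature.MathematicalPhysics.QuantumLattice.Orb (Literature.MathematicalPhysics.QuantumLattice.FermionTorus 2 L))))); c * (L : ℝ) ^ 4 * P.trace.re ≤ (P * (Matrix.conjTranspose (Literature.MathematicalPhysics.QuantumLattice.pairField Literature.MathematicalPhysics.QuantumLattice.dWaveFormFactor L) * Literature.MathematicalPhysics.QuantumLattice.pairField Literature.MathematicalPhysics.QuantumLattice.dWaveFormFactor L)).trace.re) → ∃ U ∈ Set.Ioo U₁ U₂, ∀ (N : ℕ → ℕ) (ψ : ∀ L, Literature.MathematicalPhysics.QuantumLattice.Fock (Literature.MathematicalPhysics.QuantumLattice.Orb (Literature.MathematicalPhysics.QuantumLattice.FermionTorus 2 L))), (∀ L, Even L → N L = 2 * ⌊(1 - δ) * (L : ℝ) ^ 2 / 2⌋₊ ∧ star (ψ L) ⬝ᵥ ψ L = 1 ∧ Literature.MathematicalPhysics.QuantumLattice.IsGroundStateInSector (Literature.MathematicalPhysics.QuantumLattice.hubbardTorus 2 L 1 U) (N L) 0 (ψ L)) → Literature.Probability.LatticeModels.HasLongRangeOrder (fun k => Literature.Probability.LatticeModels.halfOpenBox 2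 (2 * k)) (fun k => Literature.MathematicalPhysics.QuantumLattice.torusPullback (Literature.MathematicalPhysics.QuantumLattice.pairFieldCorr Literature.MathematicalPhysics.QuantumLattice.dWaveFormFactor ψ) (2 * k)) := by
  intro δ U₁ U₂ c hδ hU₁ hU₁₂ hc hyp
  obtain ⟨U, hU, c', hc', L₀, hL₀⟩ := h δ U₁ U₂ c hδ hU₁ hU₁₂ hc hyp
  exact ⟨U, hU, (forall_hasLRO_iff_groundState_bound U δ (by linarith [hδ.1])).2
    ⟨c', hc', L₀, fun L _ hL hLe => hL₀ L hL hLe⟩⟩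

end Summit.HubbardSuperconductivity.HubbardSuperconductivity.Theorems
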